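import Summits.BirchSwinnertonDyer.BirchSwinnertonDyer.Theorems.ResidualThetaTransportAtTwoSignedMuVanishingAtTwoPlusMultOneOldFamilyEngine
import Summits.BirchSwinnertonDyer.BirchSwinnertonDyer.Theorems.ResidualThetaTransportAtTwoSignedMuVanishingAtTwoPlusMultOneCongruence
import HarnessLib

/-!
# Route `ResidualThetaTransportAtTwo`, crux Kμ⁺ `SignedMuVanishingAtTwoPlus` (stmt-BirchSwinnertonDyer-20689), line
# `birth`, stub `stub_flatMuZeroAtTwo`: the GENERIC old-family engine — `H_S = Σ_{t ∈ S} D_t` over ANY finite set `S ⊂ ℕ⁺`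
# of odd divisor indices with `1 ∈ S`, `N₀ t ∣ N_W`; all bookkeeping EXCEPT the `U_p`-identities at the bad primes is discharged
# once and for all

Cell `bsd-wall`, width seat `bsd-wall-rtt-p4-w2` (g4). THEOREMS ONLY; helper `--supports` the crux; closes nothing. BSD is not proved
by this. The four pattern files (`…OldFamilyPrime/PrimeSq/TwoPrimes/PrimePow`) each re-proved the same plumbing (the degeneracy
conjugations `δ_t`, their matrix entries, integrality of `H`, `T_p H = a_p(g) H` off the level); here it is done for a general index
set, so that a new level pattern costs only its `U_p`-identities `T_p H_S = A_p • H_S + 2 • K` (`K` integral) at the primes `p ∣ N_W`.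

## What is proved
* `integral_sum`, `heckeT_oldSum_of_not_dvd_level`, `cuspSymbol_oldSum`: plumbing for `H_S = Σ_{t∈S} D_t` (`S : Finset ℕ+`).
* `flatAtTwo_of_namedFacts_of_oldSum`: FLAT at `(W, f)` on the habitat⁺ from the four named facts, a rational newform `g` of level
  `N₀` with eigenvalues `B p`, `B 2` even, `A p ≡ B p` off `N_W`, an index set `S` (odd, `1 ∈ S`, `N₀ t ∣ N_W`), the bad-prime
  identities `T_p H_S = A_p • H_S + 2 • K_p` with `K_p` half-period-integral, and ONE odd doubled plus symbol of `g`.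
* `flatAtTwo_turnkey_oldSum`: the same with `A p ≡ B p` off `N_W` discharged from an equivariant `W[2] ≃+ A'[2]`.

References: [AtkinLehner1970] Lemma 15; [DiamondShurman2005] §5.7, Prop. 5.8.5; [Buzzard2000LevelLoweringModTwo] Prop. 2.4;
[DarmonDiamondTaylor1995] Lemma 1.38, Lemma 4.28; [SerreInventiones1972] Prop. 12; [Mazur1978]; [EmertonPollackWeston2006] §4.4.
-/

set_option autoImplicit false
set_option linter.dupNamespace false

noncomputable section

open scoped Classical MatrixGroups ModularForm

open CongruenceSubgroup Field WeierstrassCurve Literature.NumberTheory.EllipticCurves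
  Literature.NumberTheory.EllipticCurves.ModularForms Literature.NumberTheory.EllipticCurves.Rank1Residual
  Literature.NumberTheory.IwasawaTheory Summit.BirchSwinnertonDyer.Rank1Residual.Supersingular
  Summit.BirchSwinnertonDyer.BirchSwinnertonDyer.Theses.ResidualThetaTransportAtTwo

namespace Summit.BirchSwinnertonDyer.BirchSwinnertonDyer.Theorems.SignedMuAtTwo

namespace MultOneDictionary

/-! ## §1. Plumbing for `H_S = Σ_{t ∈ S} D_t` -/

section Plumbing

variable {N₀ N : ℕ} [NeZero N₀] [NeZero N]

omit [NeZero N₀] in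
/-- Half-period integrality is stable under finite sums. [folklore] -/
theorem integral_sum (g : CuspForm (Gamma0 N₀) 2) {ι : Type*} (s : Finset ι) (F : ι → CuspForm (Gamma0 N) 2)
    (h : ∀ i ∈ s, ∀ γ : Gamma0 N, ∃ m : ℤ, (cuspSymbol (F i) γ).re = m * (plusPeriod g / 2)) :
    ∀ γ : Gamma0 N, ∃ m : ℤ, (cuspSymbol (∑ i ∈ s, F i) γ).re = m * (plusPeriod g / 2) :=
  Finset.sum_induction F (fun K ↦ ∀ γ : Gamma0 N, ∃ m : ℤ, (cuspSymbol K γ).re = m * (plusPeriod g / 2))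
    (fun _ _ h₁ h₂ ↦ integral_add g h₁ h₂) (integral_zero g) h

/-- **`T_p H_S = a_p(g) H_S` for `p ∤ N`** (`g` a newform of level `N₀`, all `N₀ t ∣ N`).
[cite: DiamondShurman2005, Prop. 5.2.2 (a), Prop. 5.8.5] [cite: AtkinLehner1970, Lemma 15] -/
theorem heckeT_oldSum_of_not_dvd_level {g : CuspForm (Gamma0 N₀) 2} (hg : IsNewform0 g) (S : Finset ℕ+)
    (hSN : ∀ t ∈ S, N₀ * (t : ℕ) ∣ N) {p : ℕ} (hp : p.Prime) (hpN : ¬ p ∣ N) :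
    (haveI : NeZero p := ⟨hp.ne_zero⟩; heckeT (Gamma0 N) 2 p (∑ t ∈ S, degeneracyMap0 N₀ N (t : ℕ) 2 g)) =
      cuspCoeff g p • ∑ t ∈ S, degeneracyMap0 N₀ N (t : ℕ) 2 g := by
  haveI : NeZero p := ⟨hp.ne_zero⟩
  rw [map_sum, Finset.smul_sum]
  exact Finset.sum_congr rfl fun t ht ↦ heckeT_D_of_not_dvd_level' hg hp hpN (hSN t ht)

/-- **The symbol of `H_S`**: `⟨H_S, γ⟩ = Σ_{t ∈ S} ⟨g, δ_t γ⟩` with `δ_t = diag(t,1) γ diag(t,1)⁻¹`.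
[cite: DarmonDiamondTaylor1995, Lemma 4.28 (p. 135)] [cite: CremonaAlgorithms1997, §2.4] -/
theorem cuspSymbol_oldSum (g : CuspForm (Gamma0 N₀) 2) (S : Finset ℕ+) (hSN : ∀ t ∈ S, N₀ * (t : ℕ) ∣ N) (γ : Gamma0 N) :
    cuspSymbol (∑ t ∈ S, degeneracyMap0 N₀ N (t : ℕ) 2 g) γ =
      ∑ t ∈ S.attach, cuspSymbol g (Gamma0.degeneracyConjElt (hSN t.1 t.2) γ) := by
  rw [← periodFunctional_apply, map_sum, ← Finset.sum_attach]
  refine Finset.sum_congr rfl fun t _ ↦ ?_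
  rw [periodFunctional_apply, cuspSymbol_degeneracyMap0 (hSN t.1 t.2)]
  rfl

end Plumbing

/-! ## §2. FLAT on the habitat⁺ from an old sum with integral `U_p`-defects -/

section Habitat

variable {W : WeierstrassCurve ℚ} [W.IsElliptic] [W.IsGloballyMinimal]

/-- **FLAT at `(W, f)` from a GENERIC old sum.** `W/ℚ` globally minimal, good supersingular at `2`, `a₂(W) = 0`, `Δ_W < 0`,
newform `f` (eigenvalues `A p`); `g` a normalised newform of level `N₀` with rational coefficients, eigenvalues `B p`, `B 2` even,
`A p ≡ B p (mod 2)` for the primes `p ∤ N_W`; an index set `S ⊂ ℕ⁺` of ODD indices with `1 ∈ S` and `N₀ t ∣ N_W` (`t ∈ S`); for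
every prime `p ∣ N_W` an identity `T_p H_S = A_p • H_S + 2 • K_p` with `K_p` half-period-integral (`H_S = Σ_{t∈S} D_t`); ONE odd
doubled plus symbol of `g`; the four named facts. THEN `2 ∤ L♭` for every Pollack pair of `f` at `2`.
[cite: Buzzard2000LevelLoweringModTwo, Prop. 2.4] [cite: DarmonDiamondTaylor1995, §1.6 Lemma 1.38 and Lemma 4.28]
[cite: SerreInventiones1972, §1.11 Prop. 12] [cite: Mazur1978, Thm. 1] [cite: EmertonPollackWeston2006, §4.4] -/
theorem flatAtTwo_of_namedFacts_of_oldSum (hBuz : buzzard2000_multiplicityOne_gamma0)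
    (hSe : serre1972_supersingular_decompositionSubgroup_image) (hSD : heckeSelfDual_torsionBy_J0)
    (hMK : mazurKenku_exists_cyclic_isogeny)
    (hss : GoodSS W 2) (ha : W.frobeniusTrace 2 = 0) (hΔ : W.Δ < 0) [NeZero (W.conductorNorm ℤ)]
    {f : CuspForm (Gamma0 (W.conductorNorm ℤ)) 2} (hf : IsNewformOf W f)
    (A : ℕ → ℤ) (hA : ∀ p : ℕ, p.Prime → cuspCoeff f p = (A p : ℂ))
    {N₀ : ℕ} [NeZero N₀] (g : CuspForm (Gamma0 N₀) 2) (hg : IsNewform0 g) (hQg : coeffField g = ⊥)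
    (B : ℕ → ℤ) (hB : ∀ p : ℕ, p.Prime → cuspCoeff g p = (B p : ℂ)) (haev : Even (B 2))
    (hcongr : ∀ p : ℕ, p.Prime → ¬ p ∣ W.conductorNorm ℤ → ((A p : ℤ) : ZMod 2) = ((B p : ℤ) : ZMod 2))
    (S : Finset ℕ+) (h1S : (1 : ℕ+) ∈ S) (hodd : ∀ t ∈ S, Odd (t : ℕ))
    (hSN : ∀ t ∈ S, N₀ * (t : ℕ) ∣ W.conductorNorm ℤ)
    (hbad : ∀ (p : ℕ) (hp : p.Prime), p ∣ W.conductorNorm ℤ → ∃ K : CuspForm (Gamma0 (W.conductorNorm ℤ)) 2,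
      (∀ γ : Gamma0 (W.conductorNorm ℤ), ∃ m : ℤ, (cuspSymbol K γ).re = m * (plusPeriod g / 2)) ∧
      (haveI : NeZero p := ⟨hp.ne_zero⟩; heckeT (Gamma0 (W.conductorNorm ℤ)) 2 p
        (∑ t ∈ S, degeneracyMap0 N₀ (W.conductorNorm ℤ) (t : ℕ) 2 g)) =
        ((A p : ℤ) : ℂ) • (∑ t ∈ S, degeneracyMap0 N₀ (W.conductorNorm ℤ) (t : ℕ) 2 g) + (2 : ℂ) • K)
    (hres : ∃ k : ℕ, 1 ≤ k ∧ ∃ b : ℤ, Odd b ∧ ∃ m : ℤ, Odd m ∧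
      ratPlusSymbol g ((b : ℚ) / 4 ^ k) = ratPlusSymbol g 0 + (m : ℚ) / 2) :
    ∀ Lplus Lminus : IwasawaAlgebra 2, IsPollackPair f 2 Lplus Lminus → ¬ PowerSeries.C (2 : ℤ_[2]) ∣ Lminus := by
  have h1 : N₀ * 1 ∣ W.conductorNorm ℤ := by simpa using hSN 1 h1S
  have h2N : ¬ 2 ∣ W.conductorNorm ℤ := by
    rw [W.dvd_conductorNorm_iff_not_hasGoodReductionAtPrime 2, not_not]
    exact hss.1
  have h2N₀ : ¬ 2 ∣ N₀ := fun h ↦ h2N (h.trans ((dvd_mul_right N₀ 1).trans h1))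
  have hΩg : plusPeriod g ≠ 0 := (IsNewform0.plusPeriod_pos_holds hg hQg).ne'
  set H : CuspForm (Gamma0 (W.conductorNorm ℤ)) 2 := ∑ t ∈ S, degeneracyMap0 N₀ (W.conductorNorm ℤ) (t : ℕ) 2 g with hHdef
  have hHint : ∀ γ, ∃ m : ℤ, (cuspSymbol H γ).re = m * (plusPeriod g / 2) :=
    integral_sum g S _ fun t ht ↦ integral_degeneracyMap0 g hΩg (hSN t ht)
  -- the degeneracy conjugations, extended by `δ_1` off the index set
  let δ : ℕ → (Gamma0 (W.conductorNorm ℤ) →* Gamma0 N₀) := fun t ↦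
    if h : N₀ * t ∣ W.conductorNorm ℤ ∧ t ≠ 0 then (haveI : NeZero t := ⟨h.2⟩; Gamma0.degeneracyConj N₀ _ t h.1)
    else Gamma0.degeneracyConj N₀ _ 1 h1
  have hδ : ∀ (t : ℕ) (h : N₀ * t ∣ W.conductorNorm ℤ) (ht : t ≠ 0) (γ : Gamma0 (W.conductorNorm ℤ)),
      δ t γ = Gamma0.degeneracyConjElt h γ := fun t h ht γ ↦ by
    simp only [δ, dif_pos (show N₀ * t ∣ W.conductorNorm ℤ ∧ t ≠ 0 from ⟨h, ht⟩), Gamma0.degeneracyConj_apply]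
  -- the index set as a set of naturals
  let S' : Finset ℕ := S.map ⟨PNat.val, PNat.coe_injective⟩
  have hmem : ∀ {t : ℕ}, t ∈ S' → ∃ t' : ℕ+, t' ∈ S ∧ (t' : ℕ) = t := fun {t} ht ↦ by
    simpa [S'] using ht
  refine flatAtTwo_of_namedFacts hBuz hSe hSD hMK hss ha hΔ hf A hA g hg hQg h2N₀ B hB haev hcongr S'
    ⟨1, Finset.mem_map.mpr ⟨1, h1S, rfl⟩⟩ (fun t ht ↦ ?_) δ (fun t ht γ ↦ ?_) (fun t ht γ ↦ ?_) (fun t ht γ ↦ ?_)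
    (fun t ht γ ↦ ?_) (fun t ht γ ↦ ?_) H (fun γ ↦ ?_) (fun p hp hpN ↦ ?_) (fun p hp hpN γ σ hσ mσ mγ hmσ hmγ ↦ ?_) hres
  · obtain ⟨t', ht', rfl⟩ := hmem ht
    exact hodd t' ht'
  · obtain ⟨t', ht', rfl⟩ := hmem ht
    rw [hδ _ (hSN t' ht') (PNat.ne_zero t')]; rfl
  · obtain ⟨t', ht', rfl⟩ := hmem ht
    rw [hδ _ (hSN t' ht') (PNat.ne_zero t')]; rfl
  · obtain ⟨t', ht', rfl⟩ := hmem ht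
    rw [hδ _ (hSN t' ht') (PNat.ne_zero t')]; rfl
  · obtain ⟨t', ht', rfl⟩ := hmem ht
    rw [hδ _ (hSN t' ht') (PNat.ne_zero t')]; rfl
  · obtain ⟨t', ht', rfl⟩ := hmem ht
    have hγ := γ.2
    rw [Gamma0_mem] at hγ
    exact (Int.natCast_dvd_natCast.mpr ((dvd_mul_left (t' : ℕ) N₀).trans (hSN t' ht'))).trans
      ((ZMod.intCast_zmod_eq_zero_iff_dvd _ _).mp hγ)
  · rw [hHdef, cuspSymbol_oldSum g S hSN γ, Finset.sum_map, ← Finset.sum_attach S]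
    refine Finset.sum_congr rfl fun t _ ↦ ?_
    change cuspSymbol g _ = cuspSymbol g (δ ((t : ℕ+) : ℕ) γ)
    rw [hδ _ (hSN t.1 t.2) (PNat.ne_zero _)]
  · rw [hHdef, heckeT_oldSum_of_not_dvd_level hg S hSN hp hpN, hB p hp]
  · haveI : NeZero p := ⟨hp.ne_zero⟩
    obtain ⟨K, hK, hT⟩ := hbad p hp hpN
    exact hbad_of_two_smul g hΩg H K hK (A p) (by rw [hHdef]; exact hT) γ σ hσ mσ mγ hmσ hmγ

/-- **Generic per-class turnkey.** As `flatAtTwo_of_namedFacts_of_oldSum`, with `A p ≡ B p (mod 2)` off `N_W` discharged from an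
equivariant `W[2] ≃+ A'[2]` for an anchor curve `A'` (conductor dividing `N_W`, newform `g`)
(`…MultOneCongruence.eigenvalue_congr_two_of_geomTorsion_equiv`). [cite: Buzzard2000LevelLoweringModTwo, Prop. 2.4]
[cite: DarmonDiamondTaylor1995, §1.6 Lemma 1.38] [cite: SerreInventiones1972, §1.11 Prop. 12] [cite: Mazur1978, Thm. 1] -/
theorem flatAtTwo_turnkey_oldSum (hBuz : buzzard2000_multiplicityOne_gamma0)
    (hSe : serre1972_supersingular_decompositionSubgroup_image) (hSD : heckeSelfDual_torsionBy_J0)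
    (hMK : mazurKenku_exists_cyclic_isogeny)
    (hss : GoodSS W 2) (ha : W.frobeniusTrace 2 = 0) (hΔ : W.Δ < 0) [NeZero (W.conductorNorm ℤ)]
    {f : CuspForm (Gamma0 (W.conductorNorm ℤ)) 2} (hf : IsNewformOf W f)
    (A : ℕ → ℤ) (hA : ∀ p : ℕ, p.Prime → cuspCoeff f p = (A p : ℂ))
    (A' : WeierstrassCurve ℚ) [A'.IsElliptic] (hNA : A'.conductorNorm ℤ ∣ W.conductorNorm ℤ)
    (e : geomTorsion W (2 : ℕ) ≃+ geomTorsion A' (2 : ℕ))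
    (he : ∀ (σ : absoluteGaloisGroup ℚ) (P : geomTorsion W (2 : ℕ)), e (σ • P) = σ • e P)
    {N₀ : ℕ} [NeZero N₀] (g : CuspForm (Gamma0 N₀) 2) (hg : IsNewformOf A' g)
    (B : ℕ → ℤ) (hB : ∀ p : ℕ, p.Prime → cuspCoeff g p = (B p : ℂ)) (hB2 : Even (B 2))
    (S : Finset ℕ+) (h1S : (1 : ℕ+) ∈ S) (hodd : ∀ t ∈ S, Odd (t : ℕ))
    (hSN : ∀ t ∈ S, N₀ * (t : ℕ) ∣ W.conductorNorm ℤ)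
    (hbad : ∀ (p : ℕ) (hp : p.Prime), p ∣ W.conductorNorm ℤ → ∃ K : CuspForm (Gamma0 (W.conductorNorm ℤ)) 2,
      (∀ γ : Gamma0 (W.conductorNorm ℤ), ∃ m : ℤ, (cuspSymbol K γ).re = m * (plusPeriod g / 2)) ∧
      (haveI : NeZero p := ⟨hp.ne_zero⟩; heckeT (Gamma0 (W.conductorNorm ℤ)) 2 p
        (∑ t ∈ S, degeneracyMap0 N₀ (W.conductorNorm ℤ) (t : ℕ) 2 g)) =
        ((A p : ℤ) : ℂ) • (∑ t ∈ S, degeneracyMap0 N₀ (W.conductorNorm ℤ) (t : ℕ) 2 g) + (2 : ℂ) • K)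
    (hres : ∃ k : ℕ, 1 ≤ k ∧ ∃ b : ℤ, Odd b ∧ ∃ m : ℤ, Odd m ∧
      ratPlusSymbol g ((b : ℚ) / 4 ^ k) = ratPlusSymbol g 0 + (m : ℚ) / 2) :
    ∀ Lplus Lminus : IwasawaAlgebra 2, IsPollackPair f 2 Lplus Lminus → ¬ PowerSeries.C (2 : ℤ_[2]) ∣ Lminus := by
  have hA2 : A 2 = 0 := by
    have := hA 2 Nat.prime_two
    rw [hf.2 2, W.LFunction_apply_prime_eq_frobeniusTrace 2 hss.1, ha] at this
    exact_mod_cast this.symm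
  have hgood := eigenvalue_congr_two_of_geomTorsion_equiv W A' e he hNA hf hg A B hA hB (by rw [hA2]; exact Even.zero) hB2
  exact flatAtTwo_of_namedFacts_of_oldSum hBuz hSe hSD hMK hss ha hΔ hf A hA g hg.1 hg.coeffField_eq_bot B hB hB2 hgood S h1S
    hodd hSN hbad hres

end Habitat

end MultOneDictionary

end Summit.BirchSwinnertonDyer.BirchSwinnertonDyer.Theorems.SignedMuAtTwo

end
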